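import Summits.NavierStokesRegularity.NavierStokesRegularity.Theses.HubbleDynamo
import Literature.Analysis.FluidPDE.AncientSimilarityVorticity

/-!
# Route HubbleDynamo — `SteadyInductionIdentity` (item stmt-NavierStokesRegularity-1937)

The steady case of the route's dictionary (card D0): for a smooth Leray profile
`−νΔU + aU + a(y·∇)U + (U·∇)U + ∇P = 0`, `div U = 0` (`IsLerayProfile ν a U P`), the vorticity
`Ω = curl U` satisfies the **steady kinematic induction equation**

  `νΔΩ + curl((U + a y) × Ω) = 0`

pointwise on `ℝ³`, i.e. `Ω` is a "magnetic field" maintained by the compressible velocity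
`V = U + a y` (`div V = 3a`, uniform Hubble expansion) with magnetic diffusivity `ν`
(Batchelor's vorticity/magnetic-field analogy made an identity by Leray's similarity variables).

## Proof

Take the curl of the profile equation, solved for the pressure gradient:
`∇P = νΔU − aU − a(y·∇)U − (U·∇)U` and `curl ∇P = 0` (`curl_gradient_eq_zero_holds`), with
`curl Δ = Δ curl` (`curl_laplacian`), `curl (aU) = aΩ` (`curl_const_smul`),
`curl ((y·∇)U) = Ω + (y·∇)Ω` (`curl_fderiv_apply_self`) and
`curl ((U·∇)U) = (U·∇)Ω − (Ω·∇)U` for `div U = 0` (`curl_convect_self_of_isDivFree`):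

  `νΔΩ = 2aΩ + a(y·∇)Ω + (U·∇)Ω − (Ω·∇)U`.

On the other side `curl (V × Ω) = (Ω·∇)V − (div V) Ω + (div Ω) V − (V·∇)Ω` (`curl_cross_apply`)
with `DV = DU + a·id`, `div V = div U + 3a = 3a`, `div Ω = 0` (`divergence_curl_eq_zero_holds`):

  `curl (V × Ω) = (Ω·∇)U + aΩ − 3aΩ − (U·∇)Ω − a(y·∇)Ω`,

and the two displays add up to zero. Physical space is `ℝ³ = EuclideanSpace ℝ (Fin 3)` throughout
(written out; no local notation).

## References

* G. K. Batchelor, Proc. R. Soc. A 201 (1950) (vorticity/magnetic-field analogy) [Batchelor1950].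
* J. Leray, Acta Math. 63 (1934), (3.12) (profile system) [Leray1934].
* J. Nečas, M. Růžička, V. Šverák, Acta Math. 176 (1996), (1.4)–(1.5) [NecasRuzickaSverak1996].
* A. J. Majda, A. L. Bertozzi, *Vorticity and Incompressible Flow* (CUP 2002), §1.1, §2.1 (2.5).
-/

noncomputable section

open Literature.Analysis.FluidPDE Set Function InnerProductSpace
open scoped RealInnerProductSpace Laplacian ContDiff

namespace Summit.NavierStokesRegularity.NavierStokesRegularity.Theorems

-- D-0017: `<Problem> = <Summit>` by design; the lakefile turns this linter off for `Summits`.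
set_option linter.dupNamespace false

/-- The Hubble wind `y ↦ a • y` on `ℝ³` has derivative `a • id` at every point. -/
theorem hubbleDynamo_hasFDerivAt_const_smul_id (a : ℝ) (x : EuclideanSpace ℝ (Fin 3)) :
    HasFDerivAt (fun y : EuclideanSpace ℝ (Fin 3) => a • y)
      (a • ContinuousLinearMap.id ℝ (EuclideanSpace ℝ (Fin 3))) x :=
  (a • ContinuousLinearMap.id ℝ (EuclideanSpace ℝ (Fin 3))).hasFDerivAt

/-- `div (a • y) = 3a` on `ℝ³` (the uniform Hubble expansion rate of `V = U + a y`). -/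
theorem hubbleDynamo_divergence_const_smul_id (a : ℝ) (x : EuclideanSpace ℝ (Fin 3)) :
    VectorCalculus.divergence (fun y : EuclideanSpace ℝ (Fin 3) => a • y) x = 3 * a := by
  rw [VectorCalculus.divergence, (hubbleDynamo_hasFDerivAt_const_smul_id a x).fderiv,
    show ((a • ContinuousLinearMap.id ℝ (EuclideanSpace ℝ (Fin 3)) :
        EuclideanSpace ℝ (Fin 3) →L[ℝ] EuclideanSpace ℝ (Fin 3)) :
        EuclideanSpace ℝ (Fin 3) →ₗ[ℝ] EuclideanSpace ℝ (Fin 3)) = a • LinearMap.id from rfl,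
    map_smul, LinearMap.trace_id, finrank_euclideanSpace, Fintype.card_fin]
  norm_num
  ring

/-- **The curl of `(U + a y) × Ω`** on `ℝ³` at a point where `U`, `Ω` are differentiable:
`curl ((U + a y) × Ω) = (Ω·∇)U + aΩ − 3aΩ − (U·∇)Ω − a (y·∇)Ω − (div U) Ω + (div Ω)(U + a y)`
(`curl_cross_apply` with `D(a y) = a id`, `div (a y) = 3a`). -/
theorem hubbleDynamo_curl_cross_add_const_smul_id_apply
    {U Ω : EuclideanSpace ℝ (Fin 3) → EuclideanSpace ℝ (Fin 3)} {x : EuclideanSpace ℝ (Fin 3)}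
    (a : ℝ) (hU : DifferentiableAt ℝ U x) (hΩ : DifferentiableAt ℝ Ω x) :
    curl (fun y => cross (U y + a • y) (Ω y)) x =
      fderiv ℝ U x (Ω x) + a • Ω x - (3 * a) • Ω x - fderiv ℝ Ω x (U x) - a • fderiv ℝ Ω x x
        - VectorCalculus.divergence U x • Ω x
        + VectorCalculus.divergence Ω x • (U x + a • x) := by
  have hlin := hubbleDynamo_hasFDerivAt_const_smul_id a x
  have hW : DifferentiableAt ℝ (fun y => U y + a • y) x := hU.add hlin.differentiableAt
  have hDW : fderiv ℝ (fun y => U y + a • y) x =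
      fderiv ℝ U x + a • ContinuousLinearMap.id ℝ (EuclideanSpace ℝ (Fin 3)) := by
    rw [fderiv_fun_add hU hlin.differentiableAt, hlin.fderiv]
  have hdivW : VectorCalculus.divergence (fun y => U y + a • y) x =
      VectorCalculus.divergence U x + 3 * a := by
    rw [divergence_add_apply hU hlin.differentiableAt, hubbleDynamo_divergence_const_smul_id]
  rw [curl_cross_apply hW hΩ, hDW, hdivW]
  simp only [add_apply, smul_apply, ContinuousLinearMap.id_apply, map_add, map_smul, add_smul,
    smul_add]
  module

/-- **Curl of the Leray profile system** (steady vorticity equation in similarity variables): for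
a Leray profile `(U, P)` on `ℝ³` with `U ∈ C³`, `P ∈ C²`, the vorticity `Ω = curl U` satisfies
`νΔΩ = 2aΩ + a(y·∇)Ω + (U·∇)Ω − (Ω·∇)U` pointwise. -/
theorem hubbleDynamo_laplacian_curl_eq {ν a : ℝ}
    {U : EuclideanSpace ℝ (Fin 3) → EuclideanSpace ℝ (Fin 3)} {P : EuclideanSpace ℝ (Fin 3) → ℝ}
    (h : IsLerayProfile ν a U P) (hU3 : ContDiff ℝ 3 U) (hP2 : ContDiff ℝ 2 P)
    (y : EuclideanSpace ℝ (Fin 3)) :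
    ν • (Δ (curl U)) y =
      (2 * a) • curl U y + a • fderiv ℝ (curl U) y y + fderiv ℝ (curl U) y (U y)
        - fderiv ℝ U y (curl U y) := by
  have hU2 : ContDiff ℝ 2 U := hU3.of_le (by norm_cast)
  have hU1 : ContDiff ℝ 1 U := hU3.of_le (by norm_cast)
  have hUd : Differentiable ℝ U := hU1.differentiable one_ne_zero
  have hDUd : Differentiable ℝ (fderiv ℝ U) :=
    (hU2.fderiv_right (m := 1) le_rfl).differentiable one_ne_zero
  -- the profile equation solved for the pressure gradient
  have hgradP : gradient P =
      fun x => ν • (Δ U) x - a • U x - a • fderiv ℝ U x x - convect U U x := by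
    funext x
    have hx := h.profile_eq x
    rw [← sub_eq_zero, ← hx]
    abel
  -- differentiability of the four terms
  have hdA' : DifferentiableAt ℝ (fun x => (Δ U) x) y := (differentiable_laplacian hU3) y
  have hdA : DifferentiableAt ℝ (fun x => ν • (Δ U) x) y := hdA'.const_smul ν
  have hdB : DifferentiableAt ℝ (fun x => a • U x) y := (hUd y).const_smul a
  have hdC' : DifferentiableAt ℝ (fun x => fderiv ℝ U x x) y :=
    (hDUd y).clm_apply differentiableAt_fun_id
  have hdC : DifferentiableAt ℝ (fun x => a • fderiv ℝ U x x) y := hdC'.const_smul a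
  have hdD : DifferentiableAt ℝ (convect U U) y := (hDUd y).clm_apply (hUd y)
  have hdAB : DifferentiableAt ℝ (fun x => ν • (Δ U) x - a • U x) y := hdA.sub hdB
  have hdABC : DifferentiableAt ℝ (fun x => ν • (Δ U) x - a • U x - a • fderiv ℝ U x x) y :=
    hdAB.sub hdC
  -- the curls of the four terms
  have e1 : curl (fun x => (Δ U) x) y = (Δ (curl U)) y := curl_laplacian hU3 y
  have e2 : curl (fun x => fderiv ℝ U x x) y = curl U y + fderiv ℝ (curl U) y y :=
    curl_fderiv_apply_self hU2 y
  have e3 : curl (convect U U) y = convect U (curl U) y - convect (curl U) U y :=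
    curl_convect_self_of_isDivFree hU2 h.divFree y
  -- `curl ∇P = 0`, expanded
  have h0 : curl (gradient P) y = 0 := curl_gradient_eq_zero_holds P hP2 y
  rw [hgradP, curl_sub hdABC hdD, curl_sub hdAB hdC, curl_sub hdA hdB, curl_const_smul hdA' ν,
    curl_const_smul (hUd y) a, curl_const_smul hdC' a, e1, e2, e3, convect_apply,
    convect_apply] at h0
  rw [← sub_eq_zero, ← h0]
  module

/-- **`SteadyInductionIdentity`** (route HubbleDynamo, item stmt-NavierStokesRegularity-1937): for
a smooth Leray profile `(U, P)` (`IsLerayProfile ν a U P`) the vorticity `Ω = curl U` solves the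
steady kinematic induction equation `νΔΩ + curl((U + a y) × Ω) = 0` pointwise on `ℝ³` — a backward
self-similar profile is a steady self-excited dynamo in the Hubble flow `V = U + a y`. -/
theorem hubbleDynamo_steadyInductionIdentity_proof :
    Summit.NavierStokesRegularity.NavierStokesRegularity.Theses.HubbleDynamo.SteadyInductionIdentity := by
  intro ν a U P hU hP h y
  have hU3 : ContDiff ℝ 3 U := hU.of_le (by norm_cast)
  have hU2 : ContDiff ℝ 2 U := hU.of_le (by norm_cast)
  have hP2 : ContDiff ℝ 2 P := hP.of_le (by norm_cast)
  have dU : DifferentiableAt ℝ U y := (hU.differentiable (by simp)) y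
  have hΩ1 : ContDiff ℝ 1 (curl U) := contDiff_curl (n := 1) (by exact_mod_cast hU2)
  have dΩ : DifferentiableAt ℝ (curl U) y := (hΩ1.differentiable one_ne_zero) y
  have hdivΩ : VectorCalculus.divergence (curl U) y = 0 := divergence_curl_eq_zero_holds U hU2 y
  rw [hubbleDynamo_curl_cross_add_const_smul_id_apply a dU dΩ, h.divFree y, hdivΩ, zero_smul,
    zero_smul, sub_zero, add_zero, hubbleDynamo_laplacian_curl_eq h hU3 hP2 y]
  module

end Summit.NavierStokesRegularity.NavierStokesRegularity.Theorems

end
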